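import Summits.CriticalPhenomena.Ising3DConformalLimit.Theses.ReflectionTwin

/-!
# `TwinThreshold` (stmt-CriticalPhenomena-16906) — negative-side anchor at zero seam coupling

Refuter helper lemmas for the crux `Summit.CriticalPhenomena.Ising3DConformalLimit.Theses.ReflectionTwin.TwinThreshold`
(route `ReflectionTwin`). At seam coupling `J = 0` every bond touching the plane `h = 0` of the typed (111) reflection
twin carries coupling `β_c(3)/2 · 0 = 0`, so the plane spin `σ₀` is isolated in every free box: the box two-point
function `⟨σ₀σ_c⟩_{TW(0),L}` vanishes for every `c ≠ 0` (spin-flip at the origin is a weight-preserving involution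
under which the observable is odd), hence `twinLat 0 2 ![0,c] = 0` and the plane-order predicate fails at `J = 0`
(`¬ LRO 0`). Consequence for the crux: the conjunct `0 < J` of `IsSeamThreshold` is exactly the content "J* > 0" —
WITHOUT it, `J = 0` is a seam threshold as soon as `LRO J'` holds for every `J' > 0` (theorem
`dropPos_threshold_zero_iff`), i.e. the positivity clause cannot be weakened away; this is the `J = 0`
anchor of the registered stub `stub_weakSeamDisorder` (W) of `Cruxes/TwinThreshold/Lines/birth.lean`.
No statement of the route is asserted here (helper / negative lane, `--supports stmt-CriticalPhenomena-16906`).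
-/

noncomputable section

namespace Summit.CriticalPhenomena.Ising3DConformalLimit.Theorems.TwinThreshold.Negative

open scoped BigOperators Classical
open Literature.Probability.LatticeModels

/-! ## Spin flip at one site (`Function.update ρ a₀ (-ρ a₀)`) -/

/-- The single-site spin flip `ρ ↦ update ρ a₀ (−ρ a₀)` is an involution. [folklore] -/
theorem flip_flip {ι : Type*} [DecidableEq ι] (a₀ : ι) (ρ : SpinConfig ι) :
    Function.update (Function.update ρ a₀ (-ρ a₀)) a₀ (-(Function.update ρ a₀ (-ρ a₀)) a₀) = ρ := by
  funext a
  by_cases h : a = a₀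
  · subst h; simp
  · simp [Function.update_of_ne h]

/-- The flipped configuration has the opposite spin at `a₀`. [folklore] -/
theorem spinAt_flip_self {ι : Type*} [DecidableEq ι] (a₀ : ι) (ρ : SpinConfig ι) :
    spinAt a₀ (Function.update ρ a₀ (-ρ a₀)) = -spinAt a₀ ρ := by
  simp [spinAt]

/-- The flip at `a₀` does not change the spin at any other site. [folklore] -/
theorem spinAt_flip_ne {ι : Type*} [DecidableEq ι] {a₀ a : ι} (h : a ≠ a₀) (ρ : SpinConfig ι) :
    spinAt a (Function.update ρ a₀ (-ρ a₀)) = spinAt a ρ := by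
  simp [spinAt, Function.update_of_ne h]

/-- If every (ordered-pair) coupling touching `a₀` vanishes, the Boltzmann weight is invariant under the spin flip
at `a₀`. [folklore] -/
theorem gibbsWeight_flip {ι : Type*} [Fintype ι] [DecidableEq ι] (c : ι → ι → ℝ) (a₀ : ι)
    (hc : ∀ a b, a = a₀ ∨ b = a₀ → c a b = 0) (ρ : SpinConfig ι) :
    PairIsing.gibbsWeight c (Function.update ρ a₀ (-ρ a₀)) = PairIsing.gibbsWeight c ρ := by
  unfold PairIsing.gibbsWeight
  congr 1
  refine Finset.sum_congr rfl fun a _ => Finset.sum_congr rfl fun b _ => ?_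
  by_cases ha : a = a₀
  · simp [hc a b (Or.inl ha)]
  by_cases hb : b = a₀
  · simp [hc a b (Or.inr hb)]
  rw [spinAt_flip_ne ha, spinAt_flip_ne hb]

/-- An observable that is odd under a weight-preserving single-site spin flip has Gibbs average zero. [folklore] -/
theorem gibbsAvg_eq_zero_of_flip_odd {ι : Type*} [Fintype ι] [DecidableEq ι] (c : ι → ι → ℝ) (a₀ : ι)
    (hc : ∀ a b, a = a₀ ∨ b = a₀ → c a b = 0) (f : SpinConfig ι → ℝ)
    (hf : ∀ ρ, f (Function.update ρ a₀ (-ρ a₀)) = -f ρ) :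
    PairIsing.gibbsAvg c f = 0 := by
  have hinv : Function.Involutive (fun ρ : SpinConfig ι => Function.update ρ a₀ (-ρ a₀)) := flip_flip a₀
  have hsum : ∑ ρ, f ρ * PairIsing.gibbsWeight c ρ =
      ∑ ρ, f (Function.update ρ a₀ (-ρ a₀)) * PairIsing.gibbsWeight c (Function.update ρ a₀ (-ρ a₀)) :=
    (Fintype.sum_equiv hinv.toPerm _ _ fun _ => rfl).symm
  have hneg : ∑ ρ, f (Function.update ρ a₀ (-ρ a₀)) * PairIsing.gibbsWeight c (Function.update ρ a₀ (-ρ a₀)) =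
      -∑ ρ, f ρ * PairIsing.gibbsWeight c ρ := by
    rw [← Finset.sum_neg_distrib]
    refine Finset.sum_congr rfl fun ρ _ => ?_
    rw [hf ρ, gibbsWeight_flip c a₀ hc ρ]
    ring
  have hzero : ∑ ρ, f ρ * PairIsing.gibbsWeight c ρ = 0 := by linarith
  unfold PairIsing.gibbsAvg
  rw [hzero, zero_div]

/-! ## The twin at zero seam coupling -/

/-- **Isolated plane spin at `J = 0`.** In the typed (111) reflection twin with seam coupling `J = 0`, every box
two-point function from the origin vanishes: `twinLat 0 2 ![0, c] = 0` for all `c ≠ 0` (the `let` header is the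
crux's, verbatim). [folklore] -/
theorem twinLat_zero_two_eq_zero : open Literature.Probability.LatticeModels in (let hZ : Site 3 → ℤ := fun z => z 0 + z 1 + z 2; let Adj : Site 3 → Site 3 → Prop := fun a b => ((∑ i, |a i - b i| = 1) ∧ ¬ ((hZ a = 0 ∧ hZ b = 1) ∨ (hZ a = 1 ∧ hZ b = 0))) ∨ (((hZ a = 0 ∧ hZ b = 1) ∨ (hZ a = 1 ∧ hZ b = 0)) ∧ ∃ i : Fin 3, a + b = Pi.single i 1); let cpl : ℝ → (L : ℕ) → ↥(box 3 L) → ↥(box 3 L) → ℝ := fun J _L a b => if Adj a.1 b.1 then (criticalBeta 3 / 2) * (if hZ a.1 = 0 ∨ hZ b.1 = 0 then J else 1) else 0; let twinLat : ℝ → (k : ℕ) → (Fin k → Site 3) → ℝ := fun J _k z => ⨆ L : ℕ, PairIsing.gibbsAvg (cpl J L) (fun s => ∏ i, if h : z i ∈ box 3 L then spinAt (⟨z i, h⟩ : ↥(box 3 L)) s else 0); ∀ c : Site 3, c ≠ 0 → twinLat 0 2 ![0, c] = 0) := by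
  intro hZ Adj cpl twinLat c hc
  -- every box term vanishes (the origin is an isolated spin at `J = 0`)
  have hL : ∀ L : ℕ, PairIsing.gibbsAvg (cpl 0 L)
      (fun s => ∏ i, if h : (![0, c] : Fin 2 → Site 3) i ∈ box 3 L
        then spinAt (⟨(![0, c] : Fin 2 → Site 3) i, h⟩ : ↥(box 3 L)) s else 0) = 0 := by
    intro L
    have h0 : (0 : Site 3) ∈ box 3 L := by simp [mem_box]
    by_cases hcL : c ∈ box 3 L
    · have hne : (⟨c, hcL⟩ : ↥(box 3 L)) ≠ ⟨0, h0⟩ := by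
        intro h
        exact hc (congrArg Subtype.val h)
      refine gibbsAvg_eq_zero_of_flip_odd (cpl 0 L) ⟨0, h0⟩ ?_ _ ?_
      · rintro a b (rfl | rfl) <;> simp [cpl, hZ]
      · intro ρ
        simp only [Fin.prod_univ_two, Matrix.cons_val_zero, Matrix.cons_val_one]
        rw [dif_pos h0, dif_pos hcL, dif_pos h0, dif_pos hcL, spinAt_flip_self, spinAt_flip_ne hne]
        ring
    · have hf : (fun s : SpinConfig ↥(box 3 L) => ∏ i, if h : (![0, c] : Fin 2 → Site 3) i ∈ box 3 L
          then spinAt (⟨(![0, c] : Fin 2 → Site 3) i, h⟩ : ↥(box 3 L)) s else 0) = fun _ => 0 := by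
        funext s
        simp only [Fin.prod_univ_two, Matrix.cons_val_zero, Matrix.cons_val_one]
        rw [dif_neg hcL, mul_zero]
      rw [hf]
      exact PairIsing.gibbsAvg_const _ 0
  dsimp only [twinLat]
  simp only [hL, ciSup_const]

/-- **No plane order at zero seam coupling** (`¬ LRO 0`): the `J = 0` anchor of stub (W) `stub_weakSeamDisorder`.
[folklore] -/
theorem not_LRO_zero : open Literature.Probability.LatticeModels in (let hZ : Site 3 → ℤ := fun z => z 0 + z 1 + z 2; let Adj : Site 3 → Site 3 → Prop := fun a b => ((∑ i, |a i - b i| = 1) ∧ ¬ ((hZ a = 0 ∧ hZ b = 1) ∨ (hZ a = 1 ∧ hZ b = 0))) ∨ (((hZ a = 0 ∧ hZ b = 1) ∨ (hZ a = 1 ∧ hZ b = 0)) ∧ ∃ i : Fin 3, a + b = Pi.single i 1); let cpl : ℝ → (L : ℕ) → ↥(box 3 L) → ↥(box 3 L) → ℝ := fun J _L a b => if Adj a.1 b.1 then (criticalBeta 3 / 2) * (if hZ a.1 = 0 ∨ hZ b.1 = 0 then J else 1) else 0; let twinLat : ℝ → (k : ℕ) → (Fin k → Site 3) → ℝ :=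 fun J _k z => ⨆ L : ℕ, PairIsing.gibbsAvg (cpl J L) (fun s => ∏ i, if h : z i ∈ box 3 L then spinAt (⟨z i, h⟩ : ↥(box 3 L)) s else 0); let LRO : ℝ → Prop := fun J => ∃ m : ℝ, 0 < m ∧ ∀ c : Site 3, hZ c = 0 → m ≤ twinLat J 2 ![0, c]; ¬ LRO 0) := by
  intro hZ Adj cpl twinLat LRO
  rintro ⟨m, hm, hle⟩
  -- the plane site e₀ - e₁ ≠ 0
  have hc0 : (Pi.single 0 1 - Pi.single 1 1 : Site 3) ≠ 0 := by
    intro h0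
    have := congrFun h0 0
    simp at this
  have h := hle (Pi.single 0 1 - Pi.single 1 1) (by simp [hZ])
  have hz : twinLat 0 2 ![0, (Pi.single 0 1 - Pi.single 1 1 : Site 3)] = 0 :=
    twinLat_zero_two_eq_zero (Pi.single 0 1 - Pi.single 1 1) hc0
  rw [hz] at h
  exact absurd h (not_le.mpr hm)

/-- **The positivity clause is the content.** Drop `0 < J` from `IsSeamThreshold J := 0 < J ∧ ¬ LRO J ∧ ∀ J' > J, LRO J'`:
then `J = 0` satisfies the remaining two clauses iff the plane orders at EVERY positive seam coupling (`J* = 0`, the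
crux's first declared risk) — because `¬ LRO 0` holds unconditionally (`not_LRO_zero`). So the conjunct `0 < J` of the
crux is not a normalisation but exactly stub (W) "J* > 0". [folklore] -/
theorem dropPos_threshold_zero_iff : open Literature.Probability.LatticeModels in (let hZ : Site 3 → ℤ := fun z => z 0 + z 1 + z 2; let Adj : Site 3 → Site 3 → Prop := fun a b => ((∑ i, |a i - b i| = 1) ∧ ¬ ((hZ a = 0 ∧ hZ b = 1) ∨ (hZ a = 1 ∧ hZ b = 0))) ∨ (((hZ a = 0 ∧ hZ b = 1) ∨ (hZ a = 1 ∧ hZ b = 0)) ∧ ∃ i : Fin 3, a + b = Pi.single i 1); let cpl : ℝ → (L : ℕ) → ↥(box 3 L) → ↥(box 3 L) → ℝ := fun J _L a b => if Adj a.1 b.1 then (criticalBeta 3 / 2) * (if hZ a.1 = 0 ∨ hZ b.1 = 0 then J else 1) else 0; let twinLat : ℝ → (k : ℕ) → (Fin k → Site 3) → ℝ := fun J _k z => ⨆ L : ℕ, PairIsing.gibbsAvg (cpl J L) (fun s => ∏ i, if h : z i ∈ box 3 L then spinAt (⟨z i, h⟩ : ↥(box 3 L)) s else 0); let LRO : ℝ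 → Prop := fun J => ∃ m : ℝ, 0 < m ∧ ∀ c : Site 3, hZ c = 0 → m ≤ twinLat J 2 ![0, c]; ((¬ LRO 0 ∧ ∀ J' : ℝ, 0 < J' → LRO J') ↔ ∀ J' : ℝ, 0 < J' → LRO J')) := by
  intro hZ Adj cpl twinLat LRO
  have h0 : ¬ LRO 0 := not_LRO_zero
  exact ⟨fun h => h.2, fun h => ⟨h0, h⟩⟩

end Summit.CriticalPhenomena.Ising3DConformalLimit.Theorems.TwinThreshold.Negative

end
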